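import Literature.NumberTheory.Sieve.SmoothRieszMeanKernel
import Literature.NumberTheory.Sieve.SmoothZetaDecayBrunTitchmarsh
import Literature.NumberTheory.LFunctions.RieszMeanDirichletSeries
import Mathlib.Analysis.SpecialFunctions.Gaussian.GaussianIntegral
import Mathlib.Analysis.SpecialFunctions.ImproperIntegrals
import Mathlib.MeasureTheory.Measure.Lebesgue.Integral
import HarnessLib

/-!
# The saddle-point evaluation of the Riesz mean of the smooth numbers

(Module docstring completed once the file is stable.)
-/

noncomputable section

open Complex MeasureTheory

namespace Literature.NumberTheory.Sieve

variable {x α t τ : ℝ} {y : ℕ}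

/-! ### The Perron kernel `1/(s(s+1))` on `Re s = α` -/

/-- The kernel `K(t) = 1/((α + it)(α + 1 + it))` of Perron's formula of order one. [folklore] -/
def perronKernel (α t : ℝ) : ℂ :=
  1 / (((α : ℂ) + t * I) * ((α : ℂ) + t * I + 1))

/-- `K(0) = 1/(α(α+1))`. [folklore] -/
theorem perronKernel_zero (α : ℝ) : perronKernel α 0 = (((1 / (α * (α + 1)) : ℝ)) : ℂ) := by
  simp [perronKernel]

/-- `‖K(t)‖ ≤ 1/(α² + t²)` (`α > 0`). [folklore] -/
theorem norm_perronKernel_le (hα : 0 < α) (t : ℝ) : ‖perronKernel α t‖ ≤ 1 / (α ^ 2 + t ^ 2) :=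
  Literature.NumberTheory.LFunctions.norm_kernel_le hα t

/-- `‖K(t)‖ ≤ 1/(α(α+1)) = K(0)` (`α > 0`): `|α + it| ≥ α`, `|α + 1 + it| ≥ α + 1`. [folklore] -/
theorem norm_perronKernel_le_zero (hα : 0 < α) (t : ℝ) : ‖perronKernel α t‖ ≤ 1 / (α * (α + 1)) := by
  rw [perronKernel, norm_div, norm_one, norm_mul]
  have h1 : α ≤ ‖(α : ℂ) + t * I‖ := by
    have := Complex.abs_re_le_norm ((α : ℂ) + t * I)
    simp [abs_of_pos hα] at this
    exact this
  have h2 : α + 1 ≤ ‖(α : ℂ) + t * I + 1‖ := by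
    have := Complex.abs_re_le_norm ((α : ℂ) + t * I + 1)
    simp [abs_of_pos (show 0 < α + 1 by linarith)] at this
    linarith [this]
  exact one_div_le_one_div_of_le (by positivity) (mul_le_mul h1 h2 (by linarith) (norm_nonneg _))

/-- `‖K(t)‖ ≤ 1/t²`. [folklore] -/
theorem norm_perronKernel_le_inv_sq (hα : 0 < α) (ht : t ≠ 0) : ‖perronKernel α t‖ ≤ 1 / t ^ 2 :=
  le_trans (norm_perronKernel_le hα t)
    (one_div_le_one_div_of_le (by positivity) (by nlinarith [sq_nonneg α]))

/-- **`K` is Lipschitz at `0`**: for `3/5 ≤ α ≤ 1` and `|t| ≤ 1/20`,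
`‖K(t) - K(0)‖ ≤ (16/5) K(0) |t|` (`K(t) - K(0) = K(t) K(0) (t² - (2α+1) i t)`). [folklore] -/
theorem norm_perronKernel_sub_zero_le (hα : 3 / 5 ≤ α) (hα1 : α ≤ 1) (ht : |t| ≤ 1 / 20) :
    ‖perronKernel α t - perronKernel α 0‖ ≤ 16 / 5 * (1 / (α * (α + 1))) * |t| := by
  have hα0 : 0 < α := by linarith
  set P : ℂ := ((α : ℂ) + t * I) * ((α : ℂ) + t * I + 1) with hP
  set P₀ : ℂ := ((α : ℂ)) * ((α : ℂ) + 1) with hP₀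
  have hP₀eq : P₀ = (((α * (α + 1) : ℝ)) : ℂ) := by rw [hP₀]; push_cast; ring
  have hP₀ne : P₀ ≠ 0 := by
    rw [hP₀eq]; exact_mod_cast (by positivity : α * (α + 1) ≠ 0)
  have hPne : P ≠ 0 := Literature.NumberTheory.LFunctions.kernelDen_ne_zero hα0 t
  have hK : perronKernel α t = 1 / P := rfl
  have hK0 : perronKernel α 0 = 1 / P₀ := by simp [perronKernel, hP₀]
  have hdiff : perronKernel α t - perronKernel α 0 = (P₀ - P) / (P * P₀) := by
    rw [hK, hK0]; field_simp
  have hnum : P₀ - P = (((t ^ 2 : ℝ)) : ℂ) - (((2 * α + 1) * t : ℝ) : ℂ) * I := by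
    rw [hP, hP₀]; push_cast
    have hI : I * I = -1 := Complex.I_mul_I
    linear_combination (-(t : ℂ) ^ 2) * hI
  have hnum_norm : ‖P₀ - P‖ ≤ |t| * (3 + |t|) := by
    rw [hnum]
    calc ‖(((t ^ 2 : ℝ)) : ℂ) - (((2 * α + 1) * t : ℝ) : ℂ) * I‖
        ≤ ‖(((t ^ 2 : ℝ)) : ℂ)‖ + ‖(((2 * α + 1) * t : ℝ) : ℂ) * I‖ := norm_sub_le _ _
      _ = t ^ 2 + (2 * α + 1) * |t| := by
          rw [norm_mul, Complex.norm_I, mul_one, Complex.norm_real, Complex.norm_real,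
            Real.norm_eq_abs, Real.norm_eq_abs, abs_of_nonneg (sq_nonneg t), abs_mul,
            abs_of_pos (by linarith : 0 < 2 * α + 1)]
      _ ≤ |t| * (3 + |t|) := by rw [← sq_abs]; nlinarith [abs_nonneg t]
  have hK0pos : 0 < 1 / (α * (α + 1)) := by positivity
  have hKnorm : ‖(1 : ℂ) / P‖ ≤ 1 / (α * (α + 1)) := by rw [← hK]; exact norm_perronKernel_le_zero hα0 t
  have hP₀norm : ‖(1 : ℂ) / P₀‖ = 1 / (α * (α + 1)) := by
    rw [hP₀eq, norm_div, norm_one, Complex.norm_real, Real.norm_eq_abs, abs_of_pos (by positivity)]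
  -- `K(0) ≤ 25/24`
  have hK0le : 1 / (α * (α + 1)) ≤ 25 / 24 := by
    rw [div_le_div_iff₀ (by positivity) (by norm_num)]; nlinarith
  rw [hdiff, show (P₀ - P) / (P * P₀) = (P₀ - P) * ((1 / P) * (1 / P₀)) by field_simp, norm_mul, norm_mul,
    hP₀norm]
  calc ‖P₀ - P‖ * (‖1 / P‖ * (1 / (α * (α + 1))))
      ≤ (|t| * (3 + |t|)) * ((1 / (α * (α + 1))) * (1 / (α * (α + 1)))) :=
        mul_le_mul hnum_norm (mul_le_mul_of_nonneg_right hKnorm hK0pos.le) (by positivity) (by positivity)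
    _ ≤ (|t| * (3 + 1 / 20)) * ((25 / 24) * (1 / (α * (α + 1)))) := by
        refine mul_le_mul ?_ (mul_le_mul_of_nonneg_right hK0le hK0pos.le) (by positivity) (by positivity)
        exact mul_le_mul_of_nonneg_left (by linarith) (abs_nonneg t)
    _ ≤ 16 / 5 * (1 / (α * (α + 1))) * |t| := by nlinarith [abs_nonneg t, hK0pos]

/-! ### The integrand near `t = 0` -/

/-- The normalised integrand `f(t) = exp(e(t)) K(t)` of the saddle-point integral. [folklore] -/
def saddleIntegrand (x α : ℝ) (y : ℕ) (t : ℝ) : ℂ :=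
  Complex.exp (saddleExponent x α y t) * perronKernel α t

/-- **The integrand on `|t| ≤ τ`**: with `α = α(x, y) ∈ [3/5, 1]`, `φ = φ₂(α, y)`, `0 < τ ≤ 1/20` and
`η = 13 τ³ log y · φ ≤ 1/2`, for `|t| ≤ τ` one has
`Re f(t) ≥ e^{-φ t²/2} K(0) (1 - (2η + (16/5)τ))` and `‖f(t)‖ ≤ e^{-φ t²/2} K(0) (1 + 2η + (16/5)τ)`
(`exp e(t) = e^{-φt²/2} exp H(t)` with `‖H(t)‖ ≤ η`, `‖exp H - 1‖ ≤ 2η`, and `‖K(t) - K(0)‖ ≤ (16/5) K(0) |t|`).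
[cite: HildebrandTenenbaum1986, §4 (proof of Lemma 11)] -/
theorem saddleIntegrand_near_zero (hx : 1 < x) (hy : 2 ≤ y) (hα : 3 / 5 ≤ saddlePoint x y)
    (hα1 : saddlePoint x y ≤ 1) (hτ : 0 < τ) (hτ20 : τ ≤ 1 / 20)
    (hη : 13 * τ ^ 3 * Real.log y * saddlePhi₂ (saddlePoint x y) y ≤ 1 / 2) (ht : |t| ≤ τ) :
    Real.exp (-(saddlePhi₂ (saddlePoint x y) y / 2 * t ^ 2)) * (1 / (saddlePoint x y * (saddlePoint x y + 1))) *
        (1 - (2 * (13 * τ ^ 3 * Real.log y * saddlePhi₂ (saddlePoint x y) y) + 16 / 5 * τ)) ≤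
      (saddleIntegrand x (saddlePoint x y) y t).re ∧
    ‖saddleIntegrand x (saddlePoint x y) y t‖ ≤
      Real.exp (-(saddlePhi₂ (saddlePoint x y) y / 2 * t ^ 2)) * (1 / (saddlePoint x y * (saddlePoint x y + 1))) *
        (1 + (2 * (13 * τ ^ 3 * Real.log y * saddlePhi₂ (saddlePoint x y) y) + 16 / 5 * τ)) := by
  set α : ℝ := saddlePoint x y with hαdef
  have hα0 : 0 < α := by linarith
  set φ : ℝ := saddlePhi₂ α y with hφ
  set η : ℝ := 13 * τ ^ 3 * Real.log y * φ with hηdef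
  set K₀ : ℝ := 1 / (α * (α + 1)) with hK₀
  have hK₀0 : 0 < K₀ := by positivity
  set Hc : ℂ := saddleExponent x α y t + ((φ / 2 * t ^ 2 : ℝ) : ℂ) with hHc
  have hHnorm : ‖Hc‖ ≤ η := norm_saddleExponent_add_le hx hy hα hτ ht
  have hη0 : 0 ≤ η := le_trans (norm_nonneg _) hHnorm
  have hHnorm1 : ‖Hc‖ ≤ 1 := by linarith
  -- `f(t) = e^{-φt²/2} · (exp Hc · K(t))`
  set g : ℝ := Real.exp (-(φ / 2 * t ^ 2)) with hg
  have hg0 : 0 < g := Real.exp_pos _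
  have hft : saddleIntegrand x α y t = (g : ℂ) * (Complex.exp Hc * perronKernel α t) := by
    rw [saddleIntegrand, show saddleExponent x α y t = ((-(φ / 2 * t ^ 2) : ℝ) : ℂ) + Hc by
      rw [hHc]; push_cast; ring, Complex.exp_add, hg, Complex.ofReal_exp]
    ring
  -- `Z = exp Hc · K(t) - K₀`, `‖Z‖ ≤ K₀ (2η + (16/5)τ)`
  set Z : ℂ := Complex.exp Hc * perronKernel α t - (K₀ : ℂ) with hZ
  have hK0eq : perronKernel α 0 = (K₀ : ℂ) := by rw [perronKernel_zero, hK₀]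
  have ht20 : |t| ≤ 1 / 20 := le_trans ht hτ20
  have hZnorm : ‖Z‖ ≤ K₀ * (2 * η + 16 / 5 * τ) := by
    have h1 : Z = (Complex.exp Hc - 1) * perronKernel α t + (perronKernel α t - perronKernel α 0) := by
      rw [hZ, hK0eq]; ring
    rw [h1]
    calc ‖(Complex.exp Hc - 1) * perronKernel α t + (perronKernel α t - perronKernel α 0)‖
        ≤ ‖Complex.exp Hc - 1‖ * ‖perronKernel α t‖ + ‖perronKernel α t - perronKernel α 0‖ := by
          refine (norm_add_le _ _).trans ?_; rw [norm_mul]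
      _ ≤ (2 * η) * K₀ + 16 / 5 * K₀ * |t| := by
          refine add_le_add (mul_le_mul ?_ (norm_perronKernel_le_zero hα0 t) (norm_nonneg _) (by positivity))
            (norm_perronKernel_sub_zero_le hα hα1 ht20)
          exact le_trans (Complex.norm_exp_sub_one_le hHnorm1) (by linarith)
      _ ≤ K₀ * (2 * η + 16 / 5 * τ) := by nlinarith [abs_nonneg t]
  have hexpK : Complex.exp Hc * perronKernel α t = (K₀ : ℂ) + Z := by rw [hZ]; ring
  constructor
  · -- real part
    rw [hft, Complex.re_ofReal_mul, hexpK]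
    have hre : K₀ - ‖Z‖ ≤ ((K₀ : ℂ) + Z).re := by
      rw [Complex.add_re, Complex.ofReal_re]
      linarith [Complex.abs_re_le_norm Z, neg_abs_le Z.re]
    calc g * K₀ * (1 - (2 * η + 16 / 5 * τ)) = g * (K₀ - K₀ * (2 * η + 16 / 5 * τ)) := by ring
      _ ≤ g * (K₀ - ‖Z‖) := mul_le_mul_of_nonneg_left (by linarith) hg0.le
      _ ≤ g * ((K₀ : ℂ) + Z).re := mul_le_mul_of_nonneg_left hre hg0.le
  · -- norm
    rw [hft, norm_mul, Complex.norm_real, Real.norm_eq_abs, abs_of_pos hg0, hexpK]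
    calc g * ‖(K₀ : ℂ) + Z‖ ≤ g * (K₀ + ‖Z‖) := by
          refine mul_le_mul_of_nonneg_left ((norm_add_le _ _).trans ?_) hg0.le
          rw [Complex.norm_real, Real.norm_eq_abs, abs_of_pos hK₀0]
      _ ≤ g * (K₀ + K₀ * (2 * η + 16 / 5 * τ)) := mul_le_mul_of_nonneg_left (by linarith) hg0.le
      _ = g * K₀ * (1 + (2 * η + 16 / 5 * τ)) := by ring

/-- **The integrand everywhere**: `‖f(t)‖ = (‖ζ(α + it, y)‖/ζ(α, y)) ‖K(t)‖` (`α > 0`). [folklore] -/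
theorem norm_saddleIntegrand (hα : 0 < α) (x : ℝ) (y : ℕ) (t : ℝ) :
    ‖saddleIntegrand x α y t‖ = ‖smoothZetaC ((α : ℂ) + t * I) y‖ / smoothZeta α y * ‖perronKernel α t‖ := by
  rw [saddleIntegrand, norm_mul, norm_exp_saddleExponent hα x y t]

/-- `‖f(t)‖ ≤ ‖K(t)‖ ≤ 1/(α² + t²)` (`α > 0`). [folklore] -/
theorem norm_saddleIntegrand_le_kernel (hα : 0 < α) (x : ℝ) (y : ℕ) (t : ℝ) :
    ‖saddleIntegrand x α y t‖ ≤ 1 / (α ^ 2 + t ^ 2) := by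
  rw [norm_saddleIntegrand hα x y t]
  have h1 : ‖smoothZetaC ((α : ℂ) + t * I) y‖ / smoothZeta α y ≤ 1 := by
    rw [div_le_one (smoothZeta_pos hα)]; exact norm_smoothZetaC_le hα t y
  calc ‖smoothZetaC ((α : ℂ) + t * I) y‖ / smoothZeta α y * ‖perronKernel α t‖
      ≤ 1 * ‖perronKernel α t‖ := mul_le_mul_of_nonneg_right h1 (norm_nonneg _)
    _ ≤ 1 / (α ^ 2 + t ^ 2) := by rw [one_mul]; exact norm_perronKernel_le hα t


/-! ### Integrability -/

/-- The integrand `f(t)` is continuous in `t` (`α > 0`). [folklore] -/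
theorem continuous_saddleIntegrand (hα : 0 < α) (x : ℝ) (y : ℕ) : Continuous (saddleIntegrand x α y) := by
  have h1 : Continuous fun t : ℝ => Complex.exp (saddleExponent x α y t) := by
    refine Complex.continuous_exp.comp (continuous_iff_continuousAt.2 fun t => ?_)
    have hre : 0 < ((α : ℂ) + (t : ℂ) * I).re := by simp [hα]
    exact ((hasDerivAt_saddleExponent (x := x) (y := y) hre).comp_ofReal).continuousAt
  have h2 : Continuous fun t : ℝ => perronKernel α t := by
    unfold perronKernel
    exact Continuous.div continuous_const (by fun_prop)
      (Literature.NumberTheory.LFunctions.kernelDen_ne_zero hα)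
  exact h1.mul h2

/-- The integrand `f(t)` is integrable on `ℝ` (`‖f(t)‖ ≤ 1/(α² + t²)`). [folklore] -/
theorem integrable_saddleIntegrand (hα : 0 < α) (x : ℝ) (y : ℕ) : Integrable (saddleIntegrand x α y) :=
  (Literature.NumberTheory.LFunctions.integrable_inv_sq_add_sq hα).mono'
    (continuous_saddleIntegrand hα x y).aestronglyMeasurable
    (Filter.Eventually.of_forall fun t => norm_saddleIntegrand_le_kernel hα x y t)

/-- `∫ c/(a² + t²) dt = c π/a` (`a > 0`), and the integrand is integrable. [folklore] -/
theorem integral_const_div_sq_add_sq {a : ℝ} (ha : 0 < a) (c : ℝ) :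
    ∫ t : ℝ, c / (a ^ 2 + t ^ 2) = c * Real.pi / a := by
  have h1 : (fun t : ℝ => c / (a ^ 2 + t ^ 2)) = fun t => (c / a ^ 2) * (1 + (t / a) ^ 2)⁻¹ := by
    funext t
    have : a ^ 2 + t ^ 2 = a ^ 2 * (1 + (t / a) ^ 2) := by field_simp
    rw [this]; field_simp
  rw [h1, integral_const_mul, MeasureTheory.Measure.integral_comp_div (fun u : ℝ => (1 + u ^ 2)⁻¹) a,
    integral_univ_inv_one_add_sq, abs_of_pos ha, smul_eq_mul]
  field_simp

/-- `t ↦ c/(a² + t²)` is integrable (`a > 0`). [folklore] -/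
theorem integrable_const_div_sq_add_sq {a : ℝ} (ha : 0 < a) (c : ℝ) :
    Integrable fun t : ℝ => c / (a ^ 2 + t ^ 2) := by
  have h := (Literature.NumberTheory.LFunctions.integrable_inv_sq_add_sq ha).const_mul c
  refine h.congr (Filter.Eventually.of_forall fun t => ?_)
  simp [div_eq_mul_inv]

/-! ### The real Riesz mean and its Mellin representation -/

/-- The Riesz mean of order one of the `y`-smooth numbers: `F_y(x) = Σ_{n ≤ x, n ∈ S(y)} (x - n)`
(`= ∫₀ˣ Ψ(t, y) dt`). [cite: HildebrandTenenbaum1986, §4 (Lemma 10)] -/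
def smoothRieszMean (x : ℝ) (y : ℕ) : ℝ :=
  ∑ n ∈ (Finset.Ioc 0 ⌊x⌋₊).filter (· ∈ Nat.smoothNumbers (y + 1)), (x - n)

/-- The Riesz mean as the `a = 1_{S(y)}` case of the tree's Perron formula:
`F_y(x) = Σ_{n ≤ x} 1_{S(y)}(n)(x - n)`. [folklore] -/
theorem smoothRieszMean_eq_sum_indicator (x : ℝ) (y : ℕ) :
    (smoothRieszMean x y : ℂ) = ∑ n ∈ Finset.Ioc 0 ⌊x⌋₊, smoothIndicator y n * (((x - n : ℝ)) : ℂ) := by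
  rw [smoothRieszMean]
  push_cast
  rw [Finset.sum_filter]
  refine Finset.sum_congr rfl fun n _ => ?_
  by_cases h : n ∈ Nat.smoothNumbers (y + 1)
  · simp [smoothIndicator, h]
  · simp [smoothIndicator, h]

/-- **The Riesz mean as a saddle-point integral**: for `x > 1`, `α > 0`,
`F_y(x) = (x^{1+α} ζ(α, y)/(2π)) ∫ exp(e(t)) K(t) dt` (Perron's formula of order one on `Re s = α`,
`L(1_{S(y)}, s) = ζ(s, y)`, and `x^{1+s} ζ(s, y) = x^{1+α} ζ(α, y) exp e(t)`).
[cite: HildebrandTenenbaum1986, §4 (4.3)] -/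
theorem smoothRieszMean_eq_integral (hx : 1 < x) (hα : 0 < α) (y : ℕ) :
    (smoothRieszMean x y : ℂ) =
      (((x ^ (1 + α) * smoothZeta α y / (2 * Real.pi) : ℝ)) : ℂ) * ∫ t : ℝ, saddleIntegrand x α y t := by
  have hx0 : 0 < x := by linarith
  have hre : 0 < ((α : ℂ)).re := by simp [hα]
  rw [smoothRieszMean_eq_sum_indicator,
    Literature.NumberTheory.LFunctions.rieszMeanOne_eq_integral_LSeries hx0 hα
      (LSeriesSummable_smoothIndicator hre y)]
  -- pointwise identity of the integrands
  have hpt : ∀ t : ℝ, (x : ℂ) ^ (1 + ((α : ℂ) + t * I)) * LSeries (smoothIndicator y) ((α : ℂ) + t * I) *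
      (1 / (((α : ℂ) + t * I) * ((α : ℂ) + t * I + 1))) =
      (((x ^ (1 + α) * smoothZeta α y : ℝ)) : ℂ) * saddleIntegrand x α y t := by
    intro t
    have hret : 0 < ((α : ℂ) + t * I).re := by simp [hα]
    rw [LSeries_smoothIndicator hret y, saddleIntegrand, exp_saddleExponent hα x y t, perronKernel]
    have hζ : ((smoothZeta α y : ℝ) : ℂ) ≠ 0 := by exact_mod_cast (smoothZeta_pos hα).ne'
    -- `x^{1+(α+it)} = x^{1+α} e^{it log x}`
    have hxpow : (x : ℂ) ^ (1 + ((α : ℂ) + t * I)) =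
        (((x ^ (1 + α) : ℝ)) : ℂ) * Complex.exp ((t * Real.log x : ℝ) * I) := by
      rw [show (1 : ℂ) + ((α : ℂ) + t * I) = (((1 + α : ℝ)) : ℂ) + t * I by push_cast; ring,
        Complex.cpow_add _ _ (by exact_mod_cast hx0.ne'), ← Complex.ofReal_cpow hx0.le]
      congr 1
      rw [Complex.cpow_def_of_ne_zero (by exact_mod_cast hx0.ne'), ← Complex.ofReal_log hx0.le]
      congr 1; push_cast; ring
    rw [hxpow]
    push_cast
    field_simp
  rw [integral_congr_ae (Filter.Eventually.of_forall hpt), integral_const_mul]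
  push_cast
  ring


/-! ### Two generic integral estimates -/

/-- **Tail estimate.** If off a measurable set `s` an integrable `f : ℝ → ℂ` is dominated by
`A e^{-bt²} + B/(a² + t²) + C/(T² + t²)`, then `‖∫_{sᶜ} f‖ ≤ A √(π/b) + Bπ/a + Cπ/T`. [folklore] -/
theorem norm_setIntegral_compl_le {f : ℝ → ℂ} {s : Set ℝ} (hs : MeasurableSet s) (hf : Integrable f)
    {A b B a C T : ℝ} (hb : 0 < b) (ha : 0 < a) (hT : 0 < T) (hA : 0 ≤ A) (hB : 0 ≤ B) (hC : 0 ≤ C)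
    (hbound : ∀ t, t ∉ s → ‖f t‖ ≤ A * Real.exp (-b * t ^ 2) + B / (a ^ 2 + t ^ 2) + C / (T ^ 2 + t ^ 2)) :
    ‖∫ t in sᶜ, f t‖ ≤ A * Real.sqrt (Real.pi / b) + B * Real.pi / a + C * Real.pi / T := by
  set G : ℝ → ℝ := fun t => A * Real.exp (-b * t ^ 2) + B / (a ^ 2 + t ^ 2) + C / (T ^ 2 + t ^ 2) with hG
  have hG1 : Integrable fun t : ℝ => A * Real.exp (-b * t ^ 2) := (integrable_exp_neg_mul_sq hb).const_mul A
  have hG2 : Integrable fun t : ℝ => B / (a ^ 2 + t ^ 2) := integrable_const_div_sq_add_sq ha B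
  have hG3 : Integrable fun t : ℝ => C / (T ^ 2 + t ^ 2) := integrable_const_div_sq_add_sq hT C
  have hGint : Integrable G := (hG1.add hG2).add hG3
  have hGnonneg : ∀ t, 0 ≤ G t := fun t => by simp only [hG]; positivity
  calc ‖∫ t in sᶜ, f t‖ ≤ ∫ t in sᶜ, ‖f t‖ := norm_integral_le_integral_norm _
    _ ≤ ∫ t in sᶜ, G t :=
        setIntegral_mono_on hf.norm.integrableOn hGint.integrableOn hs.compl fun t ht => hbound t ht
    _ ≤ ∫ t, G t := setIntegral_le_integral hGint (Filter.Eventually.of_forall hGnonneg)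
    _ = A * Real.sqrt (Real.pi / b) + B * Real.pi / a + C * Real.pi / T := by
        have hG12 : Integrable fun t : ℝ => A * Real.exp (-b * t ^ 2) + B / (a ^ 2 + t ^ 2) := hG1.add hG2
        simp only [hG]
        rw [integral_add hG12 hG3, integral_add hG1 hG2, integral_const_mul, integral_gaussian,
          integral_const_div_sq_add_sq ha, integral_const_div_sq_add_sq hT]

/-- **Gaussian core, from below.** If on `[-τ, τ]` the real part of an integrable `f : ℝ → ℂ` is at least
`c e^{-(φ/2)t²}` (`c ≥ 0`, `φ > 0`), then
`Re ∫_{[-τ,τ]} f ≥ c (√(2π/φ) - e^{-φτ²/4} √(4π/φ))`. [folklore] -/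
theorem le_re_setIntegral_Icc {f : ℝ → ℂ} {τ φ c : ℝ} (hτ : 0 ≤ τ) (hφ : 0 < φ) (hc : 0 ≤ c)
    (hf : Integrable f) (hlow : ∀ t ∈ Set.Icc (-τ) τ, c * Real.exp (-(φ / 2) * t ^ 2) ≤ (f t).re) :
    c * (Real.sqrt (2 * Real.pi / φ) - Real.exp (-(φ / 4) * τ ^ 2) * Real.sqrt (4 * Real.pi / φ)) ≤
      (∫ t in Set.Icc (-τ) τ, f t).re := by
  set g : ℝ → ℝ := fun t => c * Real.exp (-(φ / 2) * t ^ 2) with hg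
  have hgi : Integrable g := (integrable_exp_neg_mul_sq (by positivity : 0 < φ / 2)).const_mul c
  have hgnonneg : ∀ t, 0 ≤ g t := fun t => by simp only [hg]; positivity
  -- the real part of the set integral is the set integral of the real part
  have hre : (∫ t in Set.Icc (-τ) τ, f t).re = ∫ t in Set.Icc (-τ) τ, (f t).re := by
    have h := integral_re (𝕜 := ℂ) hf.integrableOn (μ := volume.restrict (Set.Icc (-τ) τ))
    simpa using h.symm
  rw [hre]
  have hmono : ∫ t in Set.Icc (-τ) τ, g t ≤ ∫ t in Set.Icc (-τ) τ, (f t).re :=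
    setIntegral_mono_on hgi.integrableOn (hf.re).integrableOn measurableSet_Icc fun t ht => hlow t ht
  refine le_trans ?_ hmono
  -- `∫_{Icc} g = ∫ g - ∫_{Iccᶜ} g ≥ c √(2π/φ) - c e^{-φτ²/4} √(4π/φ)`
  have htot : (∫ t in Set.Icc (-τ) τ, g t) + ∫ t in (Set.Icc (-τ) τ)ᶜ, g t = c * Real.sqrt (2 * Real.pi / φ) := by
    rw [integral_add_compl measurableSet_Icc hgi]
    simp only [hg]
    rw [integral_const_mul, integral_gaussian]
    congr 2
    field_simp
  -- the tail
  have hg4 : Integrable fun t : ℝ => c * Real.exp (-(φ / 4) * τ ^ 2) * Real.exp (-(φ / 4) * t ^ 2) :=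
    (integrable_exp_neg_mul_sq (by positivity : 0 < φ / 4)).const_mul _
  have htail : ∫ t in (Set.Icc (-τ) τ)ᶜ, g t ≤ c * Real.exp (-(φ / 4) * τ ^ 2) * Real.sqrt (4 * Real.pi / φ) := by
    calc ∫ t in (Set.Icc (-τ) τ)ᶜ, g t
        ≤ ∫ t in (Set.Icc (-τ) τ)ᶜ, c * Real.exp (-(φ / 4) * τ ^ 2) * Real.exp (-(φ / 4) * t ^ 2) := by
          refine setIntegral_mono_on hgi.integrableOn hg4.integrableOn measurableSet_Icc.compl fun t ht => ?_
          simp only [hg]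
          have ht2 : τ ^ 2 ≤ t ^ 2 := by
            rw [Set.mem_compl_iff, Set.mem_Icc, not_and_or, not_le, not_le] at ht
            rcases ht with h | h
            · have h1 : τ < -t := by linarith
              have := mul_self_lt_mul_self hτ h1
              nlinarith
            · have := mul_self_lt_mul_self hτ h
              nlinarith
          rw [mul_assoc, ← Real.exp_add]
          exact mul_le_mul_of_nonneg_left (Real.exp_le_exp.2 (by nlinarith)) hc
      _ ≤ ∫ t, c * Real.exp (-(φ / 4) * τ ^ 2) * Real.exp (-(φ / 4) * t ^ 2) :=
          setIntegral_le_integral hg4 (Filter.Eventually.of_forall fun t => by positivity)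
      _ = c * Real.exp (-(φ / 4) * τ ^ 2) * Real.sqrt (4 * Real.pi / φ) := by
          rw [integral_const_mul, integral_gaussian]
          congr 2
          field_simp
  have hexp0 : 0 ≤ Real.exp (-(φ / 4) * τ ^ 2) * Real.sqrt (4 * Real.pi / φ) := by positivity
  nlinarith [htot, htail, hexp0]

/-- **Gaussian core, from above.** If on `[-τ, τ]` an integrable `f : ℝ → ℂ` is dominated by
`c e^{-(φ/2)t²}`, then `‖∫_{[-τ,τ]} f‖ ≤ c √(2π/φ)`. [folklore] -/
theorem norm_setIntegral_Icc_le {f : ℝ → ℂ} {τ φ c : ℝ} (hφ : 0 < φ) (hc : 0 ≤ c) (hf : Integrable f)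
    (hup : ∀ t ∈ Set.Icc (-τ) τ, ‖f t‖ ≤ c * Real.exp (-(φ / 2) * t ^ 2)) :
    ‖∫ t in Set.Icc (-τ) τ, f t‖ ≤ c * Real.sqrt (2 * Real.pi / φ) := by
  set g : ℝ → ℝ := fun t => c * Real.exp (-(φ / 2) * t ^ 2) with hg
  have hgi : Integrable g := (integrable_exp_neg_mul_sq (by positivity : 0 < φ / 2)).const_mul c
  calc ‖∫ t in Set.Icc (-τ) τ, f t‖ ≤ ∫ t in Set.Icc (-τ) τ, ‖f t‖ := norm_integral_le_integral_norm _
    _ ≤ ∫ t in Set.Icc (-τ) τ, g t :=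
        setIntegral_mono_on hf.norm.integrableOn hgi.integrableOn measurableSet_Icc fun t ht => hup t ht
    _ ≤ ∫ t, g t := setIntegral_le_integral hgi (Filter.Eventually.of_forall fun t => by simp only [hg]; positivity)
    _ = c * Real.sqrt (2 * Real.pi / φ) := by
        simp only [hg]
        rw [integral_const_mul, integral_gaussian]
        congr 2
        field_simp


/-! ### Numerical constants -/

/-- `e^{-10} ≤ 1/20000`. [folklore] -/
theorem exp_neg_ten_le : Real.exp (-10) ≤ 1 / 20000 := by
  rw [Real.exp_neg, inv_le_comm₀ (Real.exp_pos _) (by norm_num), one_div, inv_inv]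
  have h := Real.exp_one_gt_d9
  have h1 : (2.7182818283 : ℝ) ^ 10 ≤ Real.exp 1 ^ 10 := pow_le_pow_left₀ (by norm_num) h.le 10
  have h2 : Real.exp 1 ^ 10 = Real.exp 10 := by rw [Real.exp_one_pow]; norm_num
  have h3 : (20000 : ℝ) ≤ (2.7182818283 : ℝ) ^ 10 := by norm_num
  linarith

/-- `e^{-z} ≤ 10!/z^{10}` (`z > 0`). [folklore] -/
theorem exp_neg_le_factorial_div_pow {z : ℝ} (hz : 0 < z) : Real.exp (-z) ≤ 3628800 / z ^ 10 := by
  have h := Real.pow_div_factorial_le_exp z hz.le 10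
  have hfac : ((Nat.factorial 10 : ℕ) : ℝ) = 3628800 := by norm_num [Nat.factorial]
  rw [hfac] at h
  rw [Real.exp_neg, inv_le_comm₀ (Real.exp_pos _) (by positivity), inv_div]
  exact h

/-! ### The analytic core: two-sided bounds for `∫ f` -/

set_option maxHeartbeats 1600000 in
/-- **The core estimate.** With `α = α(x,y) ∈ [3/5, 1]`, `φ = φ₂(α, y)`, `Φ = √φ ≥ 1000`, `τ = 50/Φ`,
`13 τ³ log y φ ≤ 1/40`, and a majorant `‖f(t)‖ ≤ α⁻² e^{-10} e^{-(φ/250)t²} + B/(α²+t²) + 2/(T²+t²)` off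
`[-τ, τ]` with `B Φ ≤ 1/500` and `T ≥ 80 π Φ`: `Re ∫ f ≥ 0.94/Φ` and `‖∫ f_{x'}‖ ≤ 3.25/Φ` for the integrand
`f_{x'}` attached to ANY `x'` (same `α = α(x, y)`: `‖f_{x'}(t)‖ = ‖f_x(t)‖`).
[cite: HildebrandTenenbaum1986, §4 (Lemmas 10–11)] -/
theorem saddleIntegral_core (hx : 1 < x) (hy : 2 ≤ y) (hα : 3 / 5 ≤ saddlePoint x y)
    (hα1 : saddlePoint x y ≤ 1) (hφ0 : 0 < saddlePhi₂ (saddlePoint x y) y)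
    (hΦ : 1000 ≤ Real.sqrt (saddlePhi₂ (saddlePoint x y) y))
    (hη : 13 * (50 / Real.sqrt (saddlePhi₂ (saddlePoint x y) y)) ^ 3 * Real.log y *
      saddlePhi₂ (saddlePoint x y) y ≤ 1 / 40)
    {B T : ℝ} (hB0 : 0 ≤ B) (hB : B * Real.sqrt (saddlePhi₂ (saddlePoint x y) y) ≤ 1 / 500)
    (hT : 80 * Real.pi * Real.sqrt (saddlePhi₂ (saddlePoint x y) y) ≤ T)
    (hbound : ∀ t, t ∉ Set.Icc (-(50 / Real.sqrt (saddlePhi₂ (saddlePoint x y) y)))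
        (50 / Real.sqrt (saddlePhi₂ (saddlePoint x y) y)) →
      ‖saddleIntegrand x (saddlePoint x y) y t‖ ≤
        (1 / saddlePoint x y ^ 2 * Real.exp (-10)) *
            Real.exp (-(saddlePhi₂ (saddlePoint x y) y / 250) * t ^ 2) +
          B / (saddlePoint x y ^ 2 + t ^ 2) + 2 / (T ^ 2 + t ^ 2)) :
    94 / 100 / Real.sqrt (saddlePhi₂ (saddlePoint x y) y) ≤ (∫ t, saddleIntegrand x (saddlePoint x y) y t).re ∧
      ∀ x' : ℝ, ‖∫ t, saddleIntegrand x' (saddlePoint x y) y t‖ ≤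
        325 / 100 / Real.sqrt (saddlePhi₂ (saddlePoint x y) y) := by
  set α : ℝ := saddlePoint x y with hαdef
  have hα0 : 0 < α := by linarith
  set φ : ℝ := saddlePhi₂ α y with hφdef
  set Φ : ℝ := Real.sqrt φ with hΦdef
  have hΦ0 : 0 < Φ := by linarith
  have hΦsq : Φ ^ 2 = φ := Real.sq_sqrt hφ0.le
  set τ : ℝ := 50 / Φ with hτ
  have hτ0 : 0 < τ := by positivity
  have hτ20 : τ ≤ 1 / 20 := by rw [hτ, div_le_iff₀ hΦ0]; linarith
  have hτΦ : τ * Φ = 50 := by rw [hτ]; field_simp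
  have hτsqφ : τ ^ 2 * φ = 2500 := by rw [← hΦsq]; nlinarith [hτΦ]
  have hπ := Real.pi_gt_d2
  have hπ' := Real.pi_lt_d2
  set η : ℝ := 13 * τ ^ 3 * Real.log y * φ with hηdef
  have hη40 : η ≤ 1 / 40 := hη
  have hlogy : 0 < Real.log y := Real.log_pos (by exact_mod_cast (lt_of_lt_of_le one_lt_two hy))
  have hη0 : 0 ≤ η := by positivity
  have hηhalf : η ≤ 1 / 2 := by linarith
  -- `K₀`
  set K₀ : ℝ := 1 / (α * (α + 1)) with hK₀
  have hK₀0 : 0 < K₀ := by positivity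
  have hK₀half : 1 / 2 ≤ K₀ := by
    rw [hK₀, div_le_div_iff₀ (by norm_num) (by positivity)]; nlinarith
  have hK₀le : K₀ ≤ 25 / 24 := by
    rw [hK₀, div_le_div_iff₀ (by positivity) (by norm_num)]; nlinarith
  have hαsq : 1 / α ^ 2 ≤ 25 / 9 := by
    rw [div_le_div_iff₀ (by positivity) (by norm_num)]; nlinarith
  set f : ℝ → ℂ := saddleIntegrand x α y with hfdef
  have hfint : Integrable f := integrable_saddleIntegrand hα0 x y
  set η'' : ℝ := 2 * η + 16 / 5 * τ with hη''
  have hη''le : η'' ≤ 21 / 100 := by rw [hη'']; linarith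
  have hη''0 : 0 ≤ η'' := by rw [hη'']; positivity
  -- the pointwise bounds near `0`
  have hnear : ∀ t ∈ Set.Icc (-τ) τ,
      K₀ * (1 - η'') * Real.exp (-(φ / 2) * t ^ 2) ≤ (f t).re ∧
        ‖f t‖ ≤ K₀ * (1 + η'') * Real.exp (-(φ / 2) * t ^ 2) := by
    intro t ht
    have ht' : |t| ≤ τ := abs_le.2 ⟨ht.1, ht.2⟩
    have h := saddleIntegrand_near_zero hx hy hα hα1 hτ0 hτ20 hηhalf ht'
    have heq : Real.exp (-(φ / 2 * t ^ 2)) = Real.exp (-(φ / 2) * t ^ 2) := by ring_nf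
    simp only [← hαdef, ← hφdef, ← hK₀, ← hfdef, heq] at h
    constructor
    · calc K₀ * (1 - η'') * Real.exp (-(φ / 2) * t ^ 2)
          = Real.exp (-(φ / 2) * t ^ 2) * K₀ * (1 - (2 * η + 16 / 5 * τ)) := by rw [hη'']; ring
        _ ≤ (f t).re := h.1
    · calc ‖f t‖ ≤ Real.exp (-(φ / 2) * t ^ 2) * K₀ * (1 + (2 * η + 16 / 5 * τ)) := h.2
        _ = K₀ * (1 + η'') * Real.exp (-(φ / 2) * t ^ 2) := by rw [hη'']; ring
  have h1η : 0 ≤ K₀ * (1 - η'') := mul_nonneg hK₀0.le (by linarith)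
  have hin_lo := le_re_setIntegral_Icc hτ0.le hφ0 h1η hfint (fun t ht => (hnear t ht).1)
  have hT0 : 0 < T := lt_of_lt_of_le (by positivity) hT
  -- the same bounds hold for the integrand attached to any `x'` (its norm does not depend on `x'`)
  have hnormeq : ∀ x' t : ℝ, ‖saddleIntegrand x' α y t‖ = ‖f t‖ := fun x' t => by
    rw [hfdef, norm_saddleIntegrand hα0, norm_saddleIntegrand hα0]
  have hgen : ∀ x' : ℝ,
      ‖∫ t in Set.Icc (-τ) τ, saddleIntegrand x' α y t‖ ≤ K₀ * (1 + η'') * Real.sqrt (2 * Real.pi / φ) ∧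
      ‖∫ t in (Set.Icc (-τ) τ)ᶜ, saddleIntegrand x' α y t‖ ≤
        1 / α ^ 2 * Real.exp (-10) * Real.sqrt (Real.pi / (φ / 250)) + B * Real.pi / α + 2 * Real.pi / T := by
    intro x'
    have hfint' : Integrable (saddleIntegrand x' α y) := integrable_saddleIntegrand hα0 x' y
    refine ⟨norm_setIntegral_Icc_le (τ := τ) hφ0 (by positivity : 0 ≤ K₀ * (1 + η'')) hfint'
        (fun t ht => ?_),
      norm_setIntegral_compl_le (measurableSet_Icc : MeasurableSet (Set.Icc (-τ) τ)) hfint'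
        (b := φ / 250) (a := α) (T := T) (by positivity) hα0 hT0 (by positivity) hB0 (by norm_num)
        (fun t ht => ?_)⟩
    · rw [hnormeq]; exact (hnear t ht).2
    · rw [hnormeq]; exact hbound t ht
  -- numerics for the square roots
  have hsq1 : Real.sqrt (Real.pi / (φ / 250)) ≤ 281 / 10 / Φ := by
    rw [show Real.pi / (φ / 250) = 250 * Real.pi / φ by field_simp, Real.sqrt_div' _ hφ0.le, ← hΦdef]
    refine div_le_div_of_nonneg_right ?_ hΦ0.le
    rw [Real.sqrt_le_left (by norm_num)]; nlinarith
  have hsq2 : Real.sqrt (2 * Real.pi / φ) ≤ 251 / 100 / Φ := by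
    rw [Real.sqrt_div' _ hφ0.le, ← hΦdef]
    refine div_le_div_of_nonneg_right ?_ hΦ0.le
    rw [Real.sqrt_le_left (by norm_num)]; nlinarith
  have hsq2' : 5 / 2 / Φ ≤ Real.sqrt (2 * Real.pi / φ) := by
    rw [Real.sqrt_div' _ hφ0.le, ← hΦdef]
    refine div_le_div_of_nonneg_right ?_ hΦ0.le
    rw [Real.le_sqrt (by norm_num) (by positivity)]; nlinarith
  have hsq3 : Real.sqrt (4 * Real.pi / φ) ≤ 355 / 100 / Φ := by
    rw [Real.sqrt_div' _ hφ0.le, ← hΦdef]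
    refine div_le_div_of_nonneg_right ?_ hΦ0.le
    rw [Real.sqrt_le_left (by norm_num)]; nlinarith
  have hexp625 : Real.exp (-(φ / 4) * τ ^ 2) ≤ 1 / 20000 := by
    calc Real.exp (-(φ / 4) * τ ^ 2) = Real.exp (-625) := by congr 1; nlinarith [hτsqφ]
      _ ≤ Real.exp (-10) := Real.exp_le_exp.2 (by norm_num)
      _ ≤ 1 / 20000 := exp_neg_ten_le
  -- the outer bound `≤ (2/25) K₀/Φ`
  have hnum : 1 / α ^ 2 * Real.exp (-10) * Real.sqrt (Real.pi / (φ / 250)) + B * Real.pi / α + 2 * Real.pi / T ≤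
      2 / 25 * K₀ / Φ := by
    have h1 : 1 / α ^ 2 * Real.exp (-10) * Real.sqrt (Real.pi / (φ / 250)) ≤ 4 / 1000 / Φ := by
      calc 1 / α ^ 2 * Real.exp (-10) * Real.sqrt (Real.pi / (φ / 250))
          ≤ 25 / 9 * (1 / 20000) * (281 / 10 / Φ) := by
            refine mul_le_mul (mul_le_mul hαsq exp_neg_ten_le (Real.exp_pos _).le (by norm_num)) hsq1
              (Real.sqrt_nonneg _) (by positivity)
        _ = (25 * 281 / (9 * 20000 * 10)) / Φ := by ring
        _ ≤ 4 / 1000 / Φ := div_le_div_of_nonneg_right (by norm_num) hΦ0.le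
    have h2 : B * Real.pi / α ≤ 11 / 1000 / Φ := by
      rw [div_le_div_iff₀ hα0 hΦ0]
      have hBΦ : B * Φ ≤ 1 / 500 := hB
      have : B * Real.pi * Φ = Real.pi * (B * Φ) := by ring
      rw [this]
      have h3 : Real.pi * (B * Φ) ≤ 315 / 100 * (1 / 500) :=
        mul_le_mul (by linarith) hBΦ (by positivity) (by norm_num)
      linarith
    have h3 : 2 * Real.pi / T ≤ 1 / 40 / Φ := by
      rw [div_le_div_iff₀ hT0 hΦ0]
      have := mul_le_mul_of_nonneg_left hT (by norm_num : (0 : ℝ) ≤ 1 / 40)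
      nlinarith [Real.pi_pos]
    have h4 : 4 / 1000 / Φ + 11 / 1000 / Φ + 1 / 40 / Φ ≤ 2 / 25 * K₀ / Φ := by
      rw [← add_div, ← add_div]
      refine div_le_div_of_nonneg_right ?_ hΦ0.le
      linarith
    linarith
  have hout' : ∀ x' : ℝ, ‖∫ t in (Set.Icc (-τ) τ)ᶜ, saddleIntegrand x' α y t‖ ≤ 2 / 25 * K₀ / Φ :=
    fun x' => le_trans (hgen x').2 hnum
  -- assembling
  have hsplit : ∫ t, f t = (∫ t in Set.Icc (-τ) τ, f t) + ∫ t in (Set.Icc (-τ) τ)ᶜ, f t :=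
    (integral_add_compl measurableSet_Icc hfint).symm
  have houtx : ‖∫ t in (Set.Icc (-τ) τ)ᶜ, f t‖ ≤ 2 / 25 * K₀ / Φ := hout' x
  have hre_lo : 94 / 100 / Φ ≤ (∫ t, f t).re := by
    rw [hsplit, Complex.add_re]
    have h1 : -(2 / 25 * K₀ / Φ) ≤ (∫ t in (Set.Icc (-τ) τ)ᶜ, f t).re := by
      have := Complex.abs_re_le_norm (∫ t in (Set.Icc (-τ) τ)ᶜ, f t)
      have := neg_abs_le (∫ t in (Set.Icc (-τ) τ)ᶜ, f t).re
      linarith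
    have h2 : K₀ * (1 - η'') * (5 / 2 / Φ - 1 / 20000 * (355 / 100 / Φ)) ≤ (∫ t in Set.Icc (-τ) τ, f t).re := by
      refine le_trans ?_ hin_lo
      refine mul_le_mul_of_nonneg_left ?_ h1η
      have := mul_le_mul hexp625 hsq3 (Real.sqrt_nonneg _) (by norm_num)
      linarith
    have h3 : 94 / 100 / Φ + 2 / 25 * K₀ / Φ ≤ K₀ * (1 - η'') * (5 / 2 / Φ - 1 / 20000 * (355 / 100 / Φ)) := by
      rw [show 5 / 2 / Φ - 1 / 20000 * (355 / 100 / Φ) = (5 / 2 - 355 / 2000000) / Φ by ring,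
        show K₀ * (1 - η'') * ((5 / 2 - 355 / 2000000) / Φ) = K₀ * (1 - η'') * (5 / 2 - 355 / 2000000) / Φ by ring,
        ← add_div]
      refine div_le_div_of_nonneg_right ?_ hΦ0.le
      -- `0.94 + 0.08 K₀ ≤ K₀ (0.79)(2.4998)` since `K₀ ≥ 1/2`
      have h4 : K₀ * (79 / 100) ≤ K₀ * (1 - η'') := mul_le_mul_of_nonneg_left (by linarith) hK₀0.le
      nlinarith [h4, hK₀half]
    linarith
  have hnorm_hi : ∀ x' : ℝ, ‖∫ t, saddleIntegrand x' α y t‖ ≤ 325 / 100 / Φ := by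
    intro x'
    have hfint' : Integrable (saddleIntegrand x' α y) := integrable_saddleIntegrand hα0 x' y
    rw [(integral_add_compl (measurableSet_Icc : MeasurableSet (Set.Icc (-τ) τ)) hfint').symm]
    refine le_trans (norm_add_le _ _) ?_
    have h1 : ‖∫ t in Set.Icc (-τ) τ, saddleIntegrand x' α y t‖ ≤ K₀ * (1 + η'') * (251 / 100 / Φ) :=
      le_trans (hgen x').1 (mul_le_mul_of_nonneg_left hsq2 (by positivity))
    have h1' := hout' x'
    have h2 : K₀ * (1 + η'') * (251 / 100 / Φ) + 2 / 25 * K₀ / Φ ≤ 325 / 100 / Φ := by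
      rw [show K₀ * (1 + η'') * (251 / 100 / Φ) = K₀ * (1 + η'') * (251 / 100) / Φ by ring, ← add_div]
      refine div_le_div_of_nonneg_right ?_ hΦ0.le
      have h4 : K₀ * (1 + η'') ≤ K₀ * (121 / 100) := mul_le_mul_of_nonneg_left (by linarith) hK₀0.le
      nlinarith [h4, hK₀le]
    linarith
  exact ⟨hre_lo, hnorm_hi⟩


/-! ### The range: thresholds and the majorant off `[-τ, τ]` -/

set_option maxHeartbeats 3200000 in
/-- **The range lemma.** For `x ≥ x₀`, `(log x)^4 ≤ y`, `log y ≤ (log x)^{1/5}`: `α = α(x,y) ∈ [3/5, 1)`,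
`√φ₂ ≥ 1000`, `13 τ³ log y φ₂ ≤ 1/40` for `τ = 50/√φ₂`, and off `[-τ, τ]` the integrand is dominated by
`α⁻² e^{-10} e^{-(φ₂/250)t²} + B/(α² + t²) + 2/(T² + t²)` with `B √φ₂ ≤ 1/500`, `T = κ √y ≥ 80π√φ₂`
(Gaussian regime `|t| ≤ π/log y`: `norm_smoothZetaC_le_mul_exp_gaussian`; `π/log y ≤ |t| ≤ 3`:
`exists_decaySum_ge_sqrt`; `3 ≤ |t| ≤ κ√y`: `exists_decaySum_ge_linear`; `|t| > κ√y`: `‖K(t)‖ ≤ t⁻²`).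
[cite: HildebrandTenenbaum1986, §4 (Lemma 8 and the proof of Lemma 11)] -/
theorem exists_saddle_range :
    ∃ x₀ : ℝ, ∀ (x : ℝ) (y : ℕ), x₀ ≤ x → Real.log x ^ 4 ≤ y → Real.log y ≤ Real.log x ^ (1 / 5 : ℝ) →
      1 < x ∧ 2 ≤ y ∧ 3 / 5 ≤ saddlePoint x y ∧ saddlePoint x y ≤ 1 ∧
      0 < saddlePhi₂ (saddlePoint x y) y ∧ 1000 ≤ Real.sqrt (saddlePhi₂ (saddlePoint x y) y) ∧
      13 * (50 / Real.sqrt (saddlePhi₂ (saddlePoint x y) y)) ^ 3 * Real.log y *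
        saddlePhi₂ (saddlePoint x y) y ≤ 1 / 40 ∧
      ∃ B T : ℝ, 0 ≤ B ∧ B * Real.sqrt (saddlePhi₂ (saddlePoint x y) y) ≤ 1 / 500 ∧
        80 * Real.pi * Real.sqrt (saddlePhi₂ (saddlePoint x y) y) ≤ T ∧
        ∀ t, t ∉ Set.Icc (-(50 / Real.sqrt (saddlePhi₂ (saddlePoint x y) y)))
            (50 / Real.sqrt (saddlePhi₂ (saddlePoint x y) y)) →
          ‖saddleIntegrand x (saddlePoint x y) y t‖ ≤
            (1 / saddlePoint x y ^ 2 * Real.exp (-10)) *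
                Real.exp (-(saddlePhi₂ (saddlePoint x y) y / 250) * t ^ 2) +
              B / (saddlePoint x y ^ 2 + t ^ 2) + 2 / (T ^ 2 + t ^ 2) := by
  classical
  -- ### constants from the tree
  obtain ⟨c_B, x_B, hc_B, hB⟩ := le_rpow_one_sub_saddlePoint
  obtain ⟨x₃, h35⟩ := three_fifths_le_saddlePoint
  obtain ⟨c_φ, x_φ, hc_φ, hφlo⟩ := le_saddlePhi₂_saddlePoint
  obtain ⟨x_φ', hφhi⟩ := saddlePhi₂_saddlePoint_le
  obtain ⟨c₂, hc₂, y₂, h2⟩ := exists_decaySum_ge_sqrt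
  obtain ⟨c₃, hc₃, κ, hκ, y₃, h3⟩ := exists_decaySum_ge_linear
  set A₂ : ℝ := c₂ * Real.sqrt c_B / 25 with hA₂
  set A₃ : ℝ := c₃ * c_B / 25 with hA₃
  have hsqrtcB : 0 < Real.sqrt c_B := Real.sqrt_pos.2 hc_B
  have hA₂0 : 0 < A₂ := by positivity
  have hA₃0 : 0 < A₃ := by positivity
  set u₀ : ℝ := max (max 2 (1 / (c_B * Real.log 2) + 1)) (max (2500 / (9 * c_φ)) (4225 * 10 ^ 12 / c_φ)) with hu₀
  have hu₀2 : 2 ≤ u₀ := le_trans (le_max_left _ _) (le_max_left _ _)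
  have hu₀1 : 1 ≤ u₀ := by linarith only [hu₀2]
  set L₀ : ℝ := max (max (max 16 ((y₂ : ℝ) + y₃)) (max (10 ^ 6 / c_φ) (436 / κ)))
    (max (max (7 * 10 ^ 9 / A₂ ^ 10) (7 * 10 ^ 9 / A₃ ^ 10)) (u₀ ^ 2)) with hL₀
  have hL₀16 : 16 ≤ L₀ := le_trans (le_trans (le_max_left _ _) (le_max_left _ _)) (le_max_left _ _)
  refine ⟨max (max (max x_B x₃) (max x_φ x_φ')) (Real.exp L₀), fun x y hx hy4 hylog => ?_⟩
  -- ### the range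
  have hxB : x_B ≤ x := le_trans (le_trans (le_max_left _ _) (le_max_left _ _)) (le_trans (le_max_left _ _) hx)
  have hx₃ : x₃ ≤ x := le_trans (le_trans (le_max_right _ _) (le_max_left _ _)) (le_trans (le_max_left _ _) hx)
  have hxφ : x_φ ≤ x := le_trans (le_trans (le_max_left _ _) (le_max_right _ _)) (le_trans (le_max_left _ _) hx)
  have hxφ' : x_φ' ≤ x := le_trans (le_trans (le_max_right _ _) (le_max_right _ _)) (le_trans (le_max_left _ _) hx)
  have hxexp : Real.exp L₀ ≤ x := le_trans (le_max_right _ _) hx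
  have hx1 : 1 < x := lt_of_lt_of_le (Real.one_lt_exp_iff.2 (by linarith only [hL₀16])) hxexp
  have hx0 : 0 < x := by linarith only [hx1]
  set L : ℝ := Real.log x with hL
  have hLL₀ : L₀ ≤ L := by
    have := Real.log_le_log (Real.exp_pos _) hxexp; rwa [Real.log_exp] at this
  have hL16 : 16 ≤ L := le_trans hL₀16 hLL₀
  have hLy : (y₂ : ℝ) + y₃ ≤ L := le_trans (le_trans (le_trans (le_max_right _ _) (le_max_left _ _)) (le_max_left _ _)) hLL₀
  have hLφ : 10 ^ 6 / c_φ ≤ L := le_trans (le_trans (le_trans (le_max_left _ _) (le_max_right _ _)) (le_max_left _ _)) hLL₀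
  have hLκ : 436 / κ ≤ L := le_trans (le_trans (le_trans (le_max_right _ _) (le_max_right _ _)) (le_max_left _ _)) hLL₀
  have hLA₂ : 7 * 10 ^ 9 / A₂ ^ 10 ≤ L := le_trans (le_trans (le_trans (le_max_left _ _) (le_max_left _ _)) (le_max_right _ _)) hLL₀
  have hLA₃ : 7 * 10 ^ 9 / A₃ ^ 10 ≤ L := le_trans (le_trans (le_trans (le_max_right _ _) (le_max_left _ _)) (le_max_right _ _)) hLL₀
  have hLu₀ : u₀ ^ 2 ≤ L := le_trans (le_trans (le_max_right _ _) (le_max_right _ _)) hLL₀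
  have hL0 : 0 < L := by linarith only [hL16]
  -- `r = L^{1/5}`
  set r : ℝ := L ^ (1 / 5 : ℝ) with hr
  have hr0 : 0 < r := Real.rpow_pos_of_pos hL0 _
  have hr5 : r ^ 5 = L := by
    rw [hr, ← Real.rpow_natCast, ← Real.rpow_mul hL0.le]; norm_num
  have hr1 : 1 ≤ r := by
    by_contra h; push Not at h
    have : r ^ 5 < 1 := pow_lt_one₀ hr0.le h (by norm_num)
    linarith only [this, hr5, hL16]
  have hrL : r ≤ L := by
    calc r = r * 1 := (mul_one r).symm
      _ ≤ r * r ^ 4 := mul_le_mul_of_nonneg_left (one_le_pow₀ hr1) hr0.le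
      _ = L := by rw [← hr5]; ring
  set ℓ : ℝ := Real.log y with hℓ
  have hℓr : ℓ ≤ r := hylog
  have hy_ge : L ^ 4 ≤ (y : ℝ) := hy4
  have hL4 : (16 : ℝ) ^ 4 ≤ L ^ 4 := pow_le_pow_left₀ (by norm_num) hL16 4
  have h65536 : (65536 : ℝ) ≤ y := by norm_num at hL4; linarith only [hL4, hy_ge]
  have hy0 : (0 : ℝ) < y := by linarith only [h65536]
  have hy1 : (1 : ℝ) < y := by linarith only [h65536]
  have hℓ0 : 0 < ℓ := Real.log_pos hy1
  have hyL : L ≤ (y : ℝ) := by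
    calc L ≤ L ^ 4 := by
          calc L = L * 1 * 1 * 1 := by ring
            _ ≤ L * L * L * L := by gcongr <;> linarith only [hL16]
            _ = L ^ 4 := by ring
      _ ≤ y := hy_ge
  have hℓ1 : 1 ≤ ℓ := by
    have : Real.log 16 ≤ ℓ := le_trans (Real.log_le_log (by norm_num) hL16) (Real.log_le_log hL0 hyL)
    have h16 : 1 < Real.log 16 := by
      rw [Real.lt_log_iff_exp_lt (by norm_num)]; have := Real.exp_one_lt_d9; linarith only [this]
    linarith only [this, h16]
  have hy2 : 2 ≤ y := by
    have : (2 : ℝ) ≤ y := by linarith only [h65536]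
    exact_mod_cast this
  have hyx : (y : ℝ) ≤ x := (Real.log_le_log_iff hy0 hx0).1 (le_trans hℓr hrL)
  have hlx3 : Real.log x ^ 3 ≤ y := by
    have : L ^ 3 ≤ L ^ 4 := pow_le_pow_right₀ (by linarith only [hL16]) (by norm_num)
    linarith only [this, hy_ge]
  have hy₃0 : (0 : ℝ) ≤ y₃ := Nat.cast_nonneg y₃
  have hy₂0 : (0 : ℝ) ≤ y₂ := Nat.cast_nonneg y₂
  have hyy₂' : (y₂ : ℝ) ≤ (y : ℝ) := by linarith only [hLy, hyL, hy₃0]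
  have hyy₃' : (y₃ : ℝ) ≤ (y : ℝ) := by linarith only [hLy, hyL, hy₂0]
  have hyy₂ : y₂ ≤ y := by exact_mod_cast hyy₂'
  have hyy₃ : y₃ ≤ y := by exact_mod_cast hyy₃'
  -- `u = L/ℓ ≥ r⁴ ≥ u₀`
  set u : ℝ := L / ℓ with hu
  have huℓ : u * ℓ = L := by rw [hu]; field_simp
  have hu_r4 : r ^ 4 ≤ u := by
    rw [hu, le_div_iff₀ hℓ0]
    calc r ^ 4 * ℓ ≤ r ^ 4 * r := mul_le_mul_of_nonneg_left hℓr (by positivity)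
      _ = L := by rw [← hr5]; ring
  have hu_u₀ : u₀ ≤ u := by
    have h1 : u₀ ^ 5 ≤ (r ^ 4) ^ 5 := by
      calc u₀ ^ 5 ≤ u₀ ^ 8 := pow_le_pow_right₀ hu₀1 (by norm_num)
        _ = (u₀ ^ 2) ^ 4 := by ring
        _ ≤ L ^ 4 := pow_le_pow_left₀ (by positivity) hLu₀ 4
        _ = (r ^ 4) ^ 5 := by rw [← hr5]; ring
    exact le_trans (le_of_pow_le_pow_left₀ (by norm_num) (by positivity) h1) hu_r4
  have hu2 : 2 ≤ u := le_trans hu₀2 hu_u₀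
  have hu_cB : 1 / (c_B * Real.log 2) + 1 ≤ u := le_trans (le_trans (le_max_right _ _) (le_max_left _ _)) hu_u₀
  have hu_τ : 2500 / (9 * c_φ) ≤ u := le_trans (le_trans (le_max_left _ _) (le_max_right _ _)) hu_u₀
  have hu_η : 4225 * 10 ^ 12 / c_φ ≤ u := le_trans (le_trans (le_max_right _ _) (le_max_right _ _)) hu_u₀
  have hlogu1 : 1 ≤ Real.log (u + 1) := by
    rw [Real.le_log_iff_exp_le (by linarith only [hu2])]
    have := Real.exp_one_lt_d9; linarith only [this, hu2]
  -- ### `α`, `φ`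
  set α : ℝ := saddlePoint x y with hαdef
  have hα35 : 3 / 5 ≤ α := h35 x y hx₃ hlx3 hyx
  have hα0 : 0 < α := by linarith only [hα35]
  have hEB : c_B * (u * Real.log (u + 1)) ≤ (y : ℝ) ^ (1 - α) := hB x y hxB hlx3 hyx
  have hE_cBu : c_B * u ≤ (y : ℝ) ^ (1 - α) := by
    calc c_B * u = c_B * (u * 1) := by ring
      _ ≤ c_B * (u * Real.log (u + 1)) := by gcongr
      _ ≤ (y : ℝ) ^ (1 - α) := hEB
  have hα1 : α < 1 := by
    by_contra h; push Not at h
    have h1 : (y : ℝ) ^ (1 - α) ≤ 1 := Real.rpow_le_one_of_one_le_of_nonpos hy1.le (by linarith only [h])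
    have hl2 : 0 < Real.log 2 := Real.log_pos one_lt_two
    have hlog2 : Real.log 2 ≤ Real.log (u + 1) := Real.log_le_log two_pos (by linarith only [hu2])
    have h3 : 1 / (c_B * Real.log 2) < u := by linarith only [hu_cB]
    rw [div_lt_iff₀ (by positivity)] at h3
    have h4 : 1 < c_B * (u * Real.log (u + 1)) := by
      calc (1 : ℝ) < u * (c_B * Real.log 2) := h3
        _ = c_B * (u * Real.log 2) := by ring
        _ ≤ c_B * (u * Real.log (u + 1)) := by gcongr
    linarith only [h1, h4, hEB]
  set φ : ℝ := saddlePhi₂ α y with hφdef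
  have hφlo' : c_φ * (L * ℓ) ≤ φ := hφlo x y hxφ hlx3 hyx
  have hφhi' : φ ≤ 3 * L * ℓ := hφhi x y hxφ' hlx3 hyx
  have hcφL : 10 ^ 6 ≤ c_φ * L := by rwa [div_le_iff₀ hc_φ, mul_comm] at hLφ
  have hφ_ge : (10 : ℝ) ^ 6 ≤ φ := by
    calc (10 : ℝ) ^ 6 ≤ c_φ * L := hcφL
      _ = c_φ * (L * 1) := by ring
      _ ≤ c_φ * (L * ℓ) := by gcongr
      _ ≤ φ := hφlo'
  have hφ0 : 0 < φ := by linarith only [hφ_ge]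
  set Φ : ℝ := Real.sqrt φ with hΦ
  have hΦ0 : 0 < Φ := Real.sqrt_pos.2 hφ0
  have hΦsq : Φ ^ 2 = φ := Real.sq_sqrt hφ0.le
  have hΦ1000 : 1000 ≤ Φ := by
    rw [hΦ, Real.le_sqrt (by norm_num) hφ0.le]; linarith only [hφ_ge]
  have hℓL : ℓ ≤ L := le_trans hℓr hrL
  have hΦle : Φ ≤ 17321 / 10000 * L := by
    rw [hΦ, Real.sqrt_le_left (by positivity)]
    have h1 : L * ℓ ≤ L * L := mul_le_mul_of_nonneg_left hℓL hL0.le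
    nlinarith only [hφhi', h1]
  -- `τ`, `η`
  set τ : ℝ := 50 / Φ with hτ
  have hτ0 : 0 < τ := by positivity
  have hτΦ : τ * Φ = 50 := by rw [hτ]; field_simp
  have hτsqφ : τ ^ 2 * φ = 2500 := by
    calc τ ^ 2 * φ = (τ * Φ) ^ 2 := by rw [← hΦsq]; ring
      _ = 2500 := by rw [hτΦ]; norm_num
  have hτ3φ : τ ^ 3 * φ = 2500 * τ := by
    calc τ ^ 3 * φ = τ * (τ ^ 2 * φ) := by ring
      _ = 2500 * τ := by rw [hτsqφ]; ring
  have hπ := Real.pi_gt_d2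
  have hπ' := Real.pi_lt_d4
  have hτπ : τ ≤ Real.pi / ℓ := by
    rw [hτ, div_le_div_iff₀ hΦ0 hℓ0]
    have h1 : 2500 * ℓ ≤ 9 * c_φ * L := by
      have h2 : 2500 ≤ u * (9 * c_φ) := by rwa [div_le_iff₀ (by positivity)] at hu_τ
      have h3 := mul_le_mul_of_nonneg_right h2 hℓ0.le
      calc 2500 * ℓ ≤ u * (9 * c_φ) * ℓ := h3
        _ = 9 * c_φ * (u * ℓ) := by ring
        _ = 9 * c_φ * L := by rw [huℓ]
    have h1' : 2500 * ℓ ^ 2 ≤ 9 * φ := by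
      have h4 := mul_le_mul_of_nonneg_right h1 hℓ0.le
      calc 2500 * ℓ ^ 2 = 2500 * ℓ * ℓ := by ring
        _ ≤ 9 * c_φ * L * ℓ := h4
        _ = 9 * (c_φ * (L * ℓ)) := by ring
        _ ≤ 9 * φ := by linarith only [hφlo']
    have hpi2 : 9 ≤ Real.pi ^ 2 := by
      rw [sq]; exact le_trans (by norm_num) (mul_le_mul hπ.le hπ.le (by norm_num) Real.pi_pos.le)
    have h2 : (50 * ℓ) ^ 2 ≤ (Real.pi * Φ) ^ 2 := by
      rw [mul_pow, mul_pow, hΦsq]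
      have h5 := mul_le_mul_of_nonneg_right hpi2 hφ0.le
      calc (50 : ℝ) ^ 2 * ℓ ^ 2 = 2500 * ℓ ^ 2 := by norm_num
        _ ≤ 9 * φ := h1'
        _ ≤ Real.pi ^ 2 * φ := h5
    have h3 : 50 * ℓ ≤ Real.pi * Φ := le_of_pow_le_pow_left₀ two_ne_zero (by positivity) h2
    linarith only [h3]
  have hη : 13 * τ ^ 3 * Real.log y * φ ≤ 1 / 40 := by
    rw [← hℓ, show 13 * τ ^ 3 * ℓ * φ = 13 * (τ ^ 3 * φ) * ℓ by ring, hτ3φ,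
      show 13 * (2500 * τ) * ℓ = 1625000 * ℓ / Φ by rw [hτ]; ring, div_le_iff₀ hΦ0]
    have h1 : 4225 * 10 ^ 12 * ℓ ≤ c_φ * L := by
      have h2 : 4225 * 10 ^ 12 ≤ u * c_φ := by rwa [div_le_iff₀ hc_φ] at hu_η
      have h3 := mul_le_mul_of_nonneg_right h2 hℓ0.le
      calc 4225 * 10 ^ 12 * ℓ ≤ u * c_φ * ℓ := h3
        _ = c_φ * (u * ℓ) := by ring
        _ = c_φ * L := by rw [huℓ]
    have h2 : (65 * 10 ^ 6 * ℓ) ^ 2 ≤ φ := by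
      have h4 := mul_le_mul_of_nonneg_right h1 hℓ0.le
      have h5 : (65 * 10 ^ 6 * ℓ) ^ 2 = 4225 * 10 ^ 12 * ℓ * ℓ := by ring
      have h6 : c_φ * L * ℓ = c_φ * (L * ℓ) := by ring
      rw [h5]; linarith only [h4, h6, hφlo']
    have h3 : 65 * 10 ^ 6 * ℓ ≤ Φ := by rw [hΦ, Real.le_sqrt (by positivity) hφ0.le]; exact h2
    linarith only [h3]
  -- ### the majorant
  set M₂ : ℝ := Real.exp (-(A₂ * r)) with hM₂
  set M₃ : ℝ := Real.exp (-(A₃ * r)) with hM₃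
  have hM₂0 : 0 ≤ M₂ := (Real.exp_pos _).le
  have hM₃0 : 0 ≤ M₃ := (Real.exp_pos _).le
  set T : ℝ := κ * (y : ℝ) ^ (1 / 2 : ℝ) with hT
  have hsqrty : L ^ 2 ≤ (y : ℝ) ^ (1 / 2 : ℝ) := by
    have h1 := Real.rpow_le_rpow (by positivity) hy_ge (by norm_num : (0 : ℝ) ≤ 1 / 2)
    rwa [show L ^ 4 = (L ^ 2) ^ 2 by ring, ← Real.rpow_natCast, ← Real.rpow_mul (by positivity),
      show ((2 : ℕ) : ℝ) * (1 / 2) = 1 by norm_num, Real.rpow_one] at h1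
  have hT0 : 0 < T := by rw [hT]; positivity
  have hTge : 80 * Real.pi * Φ ≤ T := by
    have h1 : κ * L ^ 2 ≤ T := by rw [hT]; exact mul_le_mul_of_nonneg_left hsqrty hκ.le
    have h2 : 436 ≤ κ * L := by rwa [div_le_iff₀ hκ, mul_comm] at hLκ
    have h3 : 436 * L ≤ κ * L ^ 2 := by
      calc 436 * L ≤ κ * L * L := mul_le_mul_of_nonneg_right h2 hL0.le
        _ = κ * L ^ 2 := by ring
    have h4 : 80 * Real.pi * Φ ≤ 80 * (31416 / 10000) * (17321 / 10000 * L) :=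
      mul_le_mul (by linarith only [hπ']) hΦle hΦ0.le (by norm_num)
    linarith only [h1, h3, h4, hL0]
  -- `M₂, M₃ ≤ 1/(1000 Φ)`
  have hM_small : ∀ {A : ℝ}, 0 < A → 7 * 10 ^ 9 / A ^ 10 ≤ L → Real.exp (-(A * r)) * Φ ≤ 1 / 1000 := by
    intro A hA hLA
    have hz : 0 < A * r := by positivity
    have h1 := exp_neg_le_factorial_div_pow hz
    have h2 : (A * r) ^ 10 = A ^ 10 * L ^ 2 := by
      rw [mul_pow, show r ^ 10 = (r ^ 5) ^ 2 by ring, hr5]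
    rw [h2] at h1
    have h3 : 7 * 10 ^ 9 ≤ A ^ 10 * L := by
      have h4 := (div_le_iff₀ (by positivity : (0 : ℝ) < A ^ 10)).1 hLA
      linarith only [h4, show L * A ^ 10 = A ^ 10 * L by ring]
    have h10 : 0 < A ^ 10 * L ^ 2 := by positivity
    calc Real.exp (-(A * r)) * Φ ≤ 3628800 / (A ^ 10 * L ^ 2) * (17321 / 10000 * L) :=
          mul_le_mul h1 hΦle hΦ0.le (by positivity)
      _ = (3628800 * 17321 / 10000) / (A ^ 10 * L) := by field_simp
      _ ≤ 1 / 1000 := by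
          rw [div_le_div_iff₀ (by positivity) (by norm_num)]; linarith only [h3]
  have hBΦ : (M₂ + M₃) * Φ ≤ 1 / 500 := by
    have e₂ := hM_small hA₂0 hLA₂
    have e₃ := hM_small hA₃0 hLA₃
    have : (M₂ + M₃) * Φ = Real.exp (-(A₂ * r)) * Φ + Real.exp (-(A₃ * r)) * Φ := by rw [hM₂, hM₃]; ring
    rw [this]; linarith only [e₂, e₃]
  -- decay of `ζ(s,y)/ζ(α,y)`
  have hζ0 : 0 < smoothZeta α y := smoothZeta_pos hα0
  refine ⟨hx1, hy2, hα35, hα1.le, hφ0, hΦ1000, hη, M₂ + M₃, T, by positivity, hBΦ, hTge, fun t ht => ?_⟩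
  have htτ : τ < |t| := by
    rw [Set.mem_Icc, not_and_or, not_le, not_le] at ht
    rcases ht with h | h
    · rw [abs_of_neg (by linarith only [h, hτ0])]; linarith only [h]
    · rw [abs_of_pos (by linarith only [h, hτ0])]; exact h
  have ht2τ : τ ^ 2 ≤ t ^ 2 := by rw [← sq_abs t]; exact pow_le_pow_left₀ hτ0.le htτ.le 2
  have hnf := norm_saddleIntegrand hα0 x y t
  have hK := norm_perronKernel_le hα0 t
  have hpos1 : 0 ≤ (1 / α ^ 2 * Real.exp (-10)) * Real.exp (-(φ / 250) * t ^ 2) := by positivity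
  have hpos2 : 0 ≤ (M₂ + M₃) / (α ^ 2 + t ^ 2) := by positivity
  have hpos3 : 0 ≤ 2 / (T ^ 2 + t ^ 2) := by positivity
  by_cases h1 : |t| ≤ Real.pi / ℓ
  · -- Gaussian regime
    have htl : |t| * Real.log y ≤ Real.pi := by rw [← hℓ]; rwa [le_div_iff₀ hℓ0] at h1
    have hg := norm_smoothZetaC_le_mul_exp_gaussian (σ := α) (y := y) (t := t) hα35 htl
    have hcG : 10 + φ / 250 * t ^ 2 ≤ 2 / (25 * Real.pi ^ 2) * t ^ 2 * φ := by
      have hpi2 : Real.pi ^ 2 ≤ 10 := by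
        rw [sq]; exact le_trans (mul_le_mul hπ'.le hπ'.le Real.pi_pos.le (by norm_num)) (by norm_num)
      have h125 : 1 / 125 ≤ 2 / (25 * Real.pi ^ 2) := by
        rw [div_le_div_iff₀ (by norm_num) (by positivity)]; linarith only [hpi2]
      have ht2φ : 0 ≤ t ^ 2 * φ := by positivity
      have h3 := mul_le_mul_of_nonneg_right h125 ht2φ
      have h4 : τ ^ 2 * φ ≤ t ^ 2 * φ := mul_le_mul_of_nonneg_right ht2τ hφ0.le
      linarith only [h3, h4, hτsqφ]
    have hratio : ‖smoothZetaC ((α : ℂ) + t * I) y‖ / smoothZeta α y ≤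
        Real.exp (-10) * Real.exp (-(φ / 250) * t ^ 2) := by
      rw [div_le_iff₀ hζ0, ← Real.exp_add]
      refine le_trans hg ?_
      rw [mul_comm]
      refine mul_le_mul_of_nonneg_right (Real.exp_le_exp.2 ?_) hζ0.le
      change -(2 / (25 * Real.pi ^ 2)) * t ^ 2 * saddlePhi₂ α y ≤ -10 + -(φ / 250) * t ^ 2
      rw [← hφdef]; linarith only [hcG]
    calc ‖saddleIntegrand x α y t‖ = ‖smoothZetaC ((α : ℂ) + t * I) y‖ / smoothZeta α y * ‖perronKernel α t‖ := hnf
      _ ≤ (Real.exp (-10) * Real.exp (-(φ / 250) * t ^ 2)) * (1 / α ^ 2) := by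
          refine mul_le_mul hratio (le_trans hK ?_) (norm_nonneg _) (by positivity)
          exact one_div_le_one_div_of_le (by positivity) (le_add_of_nonneg_right (sq_nonneg t))
      _ = (1 / α ^ 2 * Real.exp (-10)) * Real.exp (-(φ / 250) * t ^ 2) := by ring
      _ ≤ _ := by linarith only [hpos2, hpos3]
  · push Not at h1
    by_cases h2' : |t| ≤ 3
    · -- Chebyshev regime
      have hD := h2 y hyy₂ α hα35 hα1.le t h1.le h2'
      have hu_rl : (r * ℓ) ^ 2 ≤ u := by
        rw [hu, le_div_iff₀ hℓ0]
        have : ℓ ^ 3 ≤ r ^ 3 := pow_le_pow_left₀ hℓ0.le hℓr 3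
        calc (r * ℓ) ^ 2 * ℓ = r ^ 2 * ℓ ^ 3 := by ring
          _ ≤ r ^ 2 * r ^ 3 := mul_le_mul_of_nonneg_left this (by positivity)
          _ = L := by rw [← hr5]; ring
      have hE : Real.sqrt c_B * (r * ℓ) ≤ (y : ℝ) ^ ((1 - α) / 2) := by
        have h1 : (Real.sqrt c_B * (r * ℓ)) ^ 2 ≤ (y : ℝ) ^ (1 - α) := by
          rw [mul_pow, Real.sq_sqrt hc_B.le]
          calc c_B * (r * ℓ) ^ 2 ≤ c_B * u := by gcongr
            _ ≤ (y : ℝ) ^ (1 - α) := hE_cBu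
        have h2 : (y : ℝ) ^ ((1 - α) / 2) = Real.sqrt ((y : ℝ) ^ (1 - α)) := by
          rw [Real.sqrt_eq_rpow, ← Real.rpow_mul hy0.le]; ring_nf
        rw [h2, Real.le_sqrt (by positivity) (by positivity)]
        exact h1
      have hexpM : Real.exp (-(1 / 25) * ∑ p ∈ Nat.primesLE y, (p : ℝ) ^ (-α) * (1 - Real.cos (t * Real.log p))) ≤
          M₂ := by
        rw [hM₂, Real.exp_le_exp]
        have h3 : A₂ * r * ℓ ≤ c₂ / 25 * (y : ℝ) ^ ((1 - α) / 2) := by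
          rw [hA₂]
          have := mul_le_mul_of_nonneg_left hE (by positivity : 0 ≤ c₂ / 25)
          calc c₂ * Real.sqrt c_B / 25 * r * ℓ = c₂ / 25 * (Real.sqrt c_B * (r * ℓ)) := by ring
            _ ≤ _ := this
        have h4 : A₂ * r ≤ 1 / 25 * (c₂ * ((y : ℝ) ^ ((1 - α) / 2) / Real.log y)) := by
          rw [← hℓ, show 1 / 25 * (c₂ * ((y : ℝ) ^ ((1 - α) / 2) / ℓ)) = (c₂ / 25 * (y : ℝ) ^ ((1 - α) / 2)) / ℓ by ring,
            le_div_iff₀ hℓ0]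
          exact h3
        have h5 := mul_le_mul_of_nonneg_left hD (by norm_num : (0 : ℝ) ≤ 1 / 25)
        linarith only [h4, h5]
      have hratio : ‖smoothZetaC ((α : ℂ) + t * I) y‖ / smoothZeta α y ≤ M₂ := by
        rw [div_le_iff₀ hζ0]
        calc ‖smoothZetaC ((α : ℂ) + t * I) y‖ ≤ _ := norm_smoothZetaC_le_mul_exp hα35 t y
          _ ≤ smoothZeta α y * M₂ := mul_le_mul_of_nonneg_left hexpM hζ0.le
          _ = M₂ * smoothZeta α y := mul_comm _ _
      calc ‖saddleIntegrand x α y t‖ = ‖smoothZetaC ((α : ℂ) + t * I) y‖ / smoothZeta α y * ‖perronKernel α t‖ := hnf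
        _ ≤ M₂ * (1 / (α ^ 2 + t ^ 2)) := mul_le_mul hratio hK (norm_nonneg _) hM₂0
        _ ≤ (M₂ + M₃) / (α ^ 2 + t ^ 2) := by
            rw [mul_one_div]; exact div_le_div_of_nonneg_right (by linarith only [hM₃0]) (by positivity)
        _ ≤ _ := by linarith only [hpos1, hpos3]
    · push Not at h2'
      by_cases h3' : |t| ≤ T
      · -- Brun–Titchmarsh regime
        have hD := h3 y hyy₃ α hα35 hα1.le t h2'.le (by rw [hT] at h3'; exact h3')
        have hrl : r * ℓ ≤ u := by
          rw [hu, le_div_iff₀ hℓ0]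
          have : ℓ ^ 2 ≤ r ^ 2 := pow_le_pow_left₀ hℓ0.le hℓr 2
          calc r * ℓ * ℓ = r * ℓ ^ 2 := by ring
            _ ≤ r * r ^ 2 := mul_le_mul_of_nonneg_left this hr0.le
            _ = r ^ 3 := by ring
            _ ≤ r ^ 5 := pow_le_pow_right₀ hr1 (by norm_num)
            _ = L := hr5
        have hE : c_B * r * ℓ ≤ (y : ℝ) ^ (1 - α) := by
          calc c_B * r * ℓ = c_B * (r * ℓ) := by ring
            _ ≤ c_B * u := by gcongr
            _ ≤ (y : ℝ) ^ (1 - α) := hE_cBu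
        have hexpM : Real.exp (-(1 / 25) * ∑ p ∈ Nat.primesLE y, (p : ℝ) ^ (-α) * (1 - Real.cos (t * Real.log p))) ≤
            M₃ := by
          rw [hM₃, Real.exp_le_exp]
          have h4 : A₃ * r ≤ 1 / 25 * (c₃ * ((y : ℝ) ^ (1 - α) / Real.log y)) := by
            rw [← hℓ, hA₃, show 1 / 25 * (c₃ * ((y : ℝ) ^ (1 - α) / ℓ)) = (c₃ / 25 * (y : ℝ) ^ (1 - α)) / ℓ by ring,
              le_div_iff₀ hℓ0]
            have := mul_le_mul_of_nonneg_left hE (by positivity : 0 ≤ c₃ / 25)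
            calc c₃ * c_B / 25 * r * ℓ = c₃ / 25 * (c_B * r * ℓ) := by ring
              _ ≤ _ := this
          have h5 := mul_le_mul_of_nonneg_left hD (by norm_num : (0 : ℝ) ≤ 1 / 25)
          linarith only [h4, h5]
        have hratio : ‖smoothZetaC ((α : ℂ) + t * I) y‖ / smoothZeta α y ≤ M₃ := by
          rw [div_le_iff₀ hζ0]
          calc ‖smoothZetaC ((α : ℂ) + t * I) y‖ ≤ _ := norm_smoothZetaC_le_mul_exp hα35 t y
            _ ≤ smoothZeta α y * M₃ := mul_le_mul_of_nonneg_left hexpM hζ0.le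
            _ = M₃ * smoothZeta α y := mul_comm _ _
        calc ‖saddleIntegrand x α y t‖ = ‖smoothZetaC ((α : ℂ) + t * I) y‖ / smoothZeta α y * ‖perronKernel α t‖ := hnf
          _ ≤ M₃ * (1 / (α ^ 2 + t ^ 2)) := mul_le_mul hratio hK (norm_nonneg _) hM₃0
          _ ≤ (M₂ + M₃) / (α ^ 2 + t ^ 2) := by
              rw [mul_one_div]; exact div_le_div_of_nonneg_right (by linarith only [hM₂0]) (by positivity)
          _ ≤ _ := by linarith only [hpos1, hpos3]
      · -- trivial regime `|t| > T`
        push Not at h3'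
        have htne : t ≠ 0 := by intro h; rw [h, abs_zero] at h3'; linarith only [h3', hT0]
        have hKt := norm_perronKernel_le_inv_sq hα0 htne
        have ht2T : T ^ 2 ≤ t ^ 2 := by rw [← sq_abs t]; exact pow_le_pow_left₀ hT0.le h3'.le 2
        have hratio : ‖smoothZetaC ((α : ℂ) + t * I) y‖ / smoothZeta α y ≤ 1 := by
          rw [div_le_one hζ0]; exact norm_smoothZetaC_le hα0 t y
        calc ‖saddleIntegrand x α y t‖ = ‖smoothZetaC ((α : ℂ) + t * I) y‖ / smoothZeta α y * ‖perronKernel α t‖ := hnf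
          _ ≤ 1 * (1 / t ^ 2) := mul_le_mul hratio hKt (norm_nonneg _) zero_le_one
          _ ≤ 2 / (T ^ 2 + t ^ 2) := by
              rw [one_mul, div_le_div_iff₀ (by positivity) (by positivity)]; linarith only [ht2T]
          _ ≤ _ := by linarith only [hpos1, hpos2]

/-! ### The two-sided saddle-point estimate for the Riesz mean -/

/-- **Hildebrand–Tenenbaum's saddle-point theorem for the Riesz mean, up to absolute constants.** For
`x ≥ x₀` and `(log x)^4 ≤ y ≤ exp((log x)^{1/5})`, with `α = α(x, y)`,
`F_y(x) = Σ_{n ≤ x, n ∈ S(y)} (x - n) ≍ x^{1+α} ζ(α, y)/√(φ₂(α, y))`; precisely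
`(1/25) M ≤ F_y(x)` and, for every `x' > 1`, `F_y(x') ≤ (13/25) x'^{1+α} ζ(α, y)/√φ₂(α, y)` with the SAME
`α = α(x, y)` (so in particular `F_y(x) ≤ (13/25) M`), `M = x^{1+α} ζ(α, y)/√φ₂(α, y)`. This is the
order-one Riesz-mean form of
[HildebrandTenenbaum1986, Thm 1 (2.3)] `Ψ(x, y) = x^α ζ(α, y)/(α √(2π φ₂(α, y))) (1 + O(1/u + log y/y))`
(there uniformly in `x ≥ y ≥ 2`; here in a polylogarithmic-and-above range and up to constants, by the
argument of §4: Perron's formula of order one on `Re s = α`, the Gaussian range `|t| ≤ 50/√φ₂` where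
`φ(α+it) - φ(α) + it log x = -φ₂t²/2 + O(τ³ log y φ₂)`, and the decay of `ζ(s, y)/ζ(α, y)` for larger
`|t|` from Chebyshev's bounds and the Brun–Titchmarsh inequality in place of Lemma 8).
[cite: HildebrandTenenbaum1986, Thm 1 (2.3) and §4 (Lemmas 10–11)] -/
theorem smoothRieszMean_two_sided :
    ∃ x₀ : ℝ, ∀ (x : ℝ) (y : ℕ), x₀ ≤ x → Real.log x ^ 4 ≤ y → Real.log y ≤ Real.log x ^ (1 / 5 : ℝ) →
      1 / 25 * (x ^ (1 + saddlePoint x y) * smoothZeta (saddlePoint x y) y /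
          Real.sqrt (saddlePhi₂ (saddlePoint x y) y)) ≤ smoothRieszMean x y ∧
      ∀ x' : ℝ, 1 < x' → smoothRieszMean x' y ≤ 13 / 25 * (x' ^ (1 + saddlePoint x y) *
          smoothZeta (saddlePoint x y) y / Real.sqrt (saddlePhi₂ (saddlePoint x y) y)) := by
  obtain ⟨x₀, hR⟩ := exists_saddle_range
  refine ⟨x₀, fun x y hx hy4 hylog => ?_⟩
  obtain ⟨hx1, hy2, hα35, hα1, hφ0, hΦ1000, hη, B, T, hB0, hB, hT, hbound⟩ := hR x y hx hy4 hylog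
  obtain ⟨hre_lo, hnorm_hi⟩ := saddleIntegral_core hx1 hy2 hα35 hα1 hφ0 hΦ1000 hη hB0 hB hT hbound
  set α : ℝ := saddlePoint x y with hαdef
  have hα0 : 0 < α := by linarith
  set Φ : ℝ := Real.sqrt (saddlePhi₂ α y) with hΦ
  have hΦ0 : 0 < Φ := by linarith
  have hζ0 : 0 < smoothZeta α y := smoothZeta_pos hα0
  have hπ := Real.pi_gt_d2
  have hπ' := Real.pi_lt_d2
  have hS : ∀ x' : ℝ, 1 < x' → smoothRieszMean x' y = x' ^ (1 + α) * smoothZeta α y / (2 * Real.pi) *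
      (∫ t, saddleIntegrand x' α y t).re := by
    intro x' hx'
    have h := smoothRieszMean_eq_integral hx' hα0 y
    have h2 := congrArg Complex.re h
    rw [Complex.ofReal_re, Complex.re_ofReal_mul] at h2
    exact h2
  constructor
  · have hx0 : 0 < x := by linarith
    have hpref : 0 < x ^ (1 + α) * smoothZeta α y := mul_pos (Real.rpow_pos_of_pos hx0 _) hζ0
    rw [hS x hx1, show 1 / 25 * (x ^ (1 + α) * smoothZeta α y / Φ) = x ^ (1 + α) * smoothZeta α y * (1 / 25 / Φ) by ring,
      show x ^ (1 + α) * smoothZeta α y / (2 * Real.pi) * (∫ t, saddleIntegrand x α y t).re =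
        x ^ (1 + α) * smoothZeta α y * ((∫ t, saddleIntegrand x α y t).re / (2 * Real.pi)) by ring]
    refine mul_le_mul_of_nonneg_left ?_ hpref.le
    rw [le_div_iff₀ (by positivity)]
    calc 1 / 25 / Φ * (2 * Real.pi) = (2 * Real.pi / 25) / Φ := by ring
      _ ≤ 94 / 100 / Φ := div_le_div_of_nonneg_right (by linarith) hΦ0.le
      _ ≤ (∫ t, saddleIntegrand x α y t).re := hre_lo
  · intro x' hx'
    have hx0 : 0 < x' := by linarith
    have hpref : 0 < x' ^ (1 + α) * smoothZeta α y := mul_pos (Real.rpow_pos_of_pos hx0 _) hζ0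
    have hre_le_norm : (∫ t, saddleIntegrand x' α y t).re ≤ ‖∫ t, saddleIntegrand x' α y t‖ :=
      le_trans (le_abs_self _) (Complex.abs_re_le_norm _)
    rw [hS x' hx', show 13 / 25 * (x' ^ (1 + α) * smoothZeta α y / Φ) = x' ^ (1 + α) * smoothZeta α y * (13 / 25 / Φ) by ring,
      show x' ^ (1 + α) * smoothZeta α y / (2 * Real.pi) * (∫ t, saddleIntegrand x' α y t).re =
        x' ^ (1 + α) * smoothZeta α y * ((∫ t, saddleIntegrand x' α y t).re / (2 * Real.pi)) by ring]
    refine mul_le_mul_of_nonneg_left ?_ hpref.le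
    rw [div_le_iff₀ (by positivity)]
    calc (∫ t, saddleIntegrand x' α y t).re ≤ 325 / 100 / Φ := le_trans hre_le_norm (hnorm_hi x')
      _ ≤ (26 * Real.pi / 25) / Φ := div_le_div_of_nonneg_right (by linarith) hΦ0.le
      _ = 13 / 25 / Φ * (2 * Real.pi) := by ring

end Literature.NumberTheory.Sieve

end
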